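import Literature.MathematicalPhysics.QuantumFieldTheory.Balaban1983to89.B2Eq236Replacements

/-!
# `Balaban1983to89.B2Eq237FormSplit` — [Balaban1982Higgs2] (2.37) p. 565 (part 2 of the vector-field replacements; part 1 =
(2.36) and the decay engines is `…B2Eq236Replacements`): the split of `½⟨B, Δ^{(1),L}_{Λ₅}B⟩` along `B = Λ′₆ᶜB + Λ′₆B` — the
exact identity PROVED and the `O(ε^κ)|Λ′₅|` error PROVED from the Proposition I.2.3 decay shapes ((I.2.34), (I.2.36)) + the
separation of (2.8), *"for arbitrary κ"* via `…B2StepK.rDecayBeatsPowers`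

statement-level skeleton of published theorems with citation tags; proofs where landed; nothing here is a claim about the Yang–Mills mass gap

PDF held: `paper:balaban1982-cmp86-higgs23-ii` (T. Bałaban, *(Higgs)₂,₃ quantum fields in a finite volume. II. An upper
bound*, Commun. Math. Phys. **86** (1982) 555–594, doi 10.1007/bf01214890; journal page = PDF page + 554); p. 565 [PDF 11]
READ AS AN IMAGE on the ×2 render
`run/shared/lean/pub/pub-balaban/b2b-balaban-ref1/pages/1982-cmp86-higgs23-II/1982-cmp86-higgs23-II-p011-x2.png` + its OCR
text layer (for the set subscripts `Λ′₅∩Λ′₆ᶜ`, `Λ′₆∩Λ′₇ᶜ`); part I [Balaban1982Higgs1] Prop. 2.3 pp. 611–612 [PDF 9–10].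

CITATION HEADER — WHAT IS REPRODUCED.  SKELETON row **B2.Eq2.42** ((2.20)–(2.42)), member **(2.37)** p. 565.  Unit
`lit-balaban-p15` gen 3 (Phase-2 proof seat p15; HOME `run/shared/lean/pub/lit-balaban/`, seat dir `lit-balaban-p15/`); B2 fold
owner r02, second reader r14; referee ref-4.  Inputs by name: r02's (2.27) operator `B2Eq224FirstStepFields.delta227`,
`dot_mulVec_comm`, `covΛ_mulVec_eq_zero` (p248319) and `B2Eq218Translation.restrict`; part 1's engines `bilin_far_bound` /
`bilin_damped_bound` (on p23 g4's `B2Lemma25Proof.far_sum_bound` / `damped_sum_bound`, p247392) and `pFn_nonneg`,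
`abs_Qs_restrict_le`, `exists_of_Qs_restrict_ne_zero`; r14's `B2StepK.rDecayBeatsPowers` enters through part 1's
`decay_thresholds_pow` (the constant `C_κ` is a hypothesis of `eq237_error_pow`, supplied by that theorem).

WHAT IS PRINTED (p. 565 [PDF 11], verbatim).  *"½⟨B, Δ^{(1),L}_{Λ₅}B⟩ = ½⟨Λ′₆ᶜB, Δ^{(1),L}_{Λ₅}Λ′₆ᶜB⟩
− a²L⁻⁴⟨(Λ′₅∩Λ′₆ᶜ)B, QC^{(0)}_{Λ₅}Q*(Λ′₆∩Λ′₇ᶜ)B⟩ + ½⟨Λ′₆B, Δ^{(1),L}Λ′₆B⟩ + O(ε^κ)|Λ′₅|,   (2.37)  for arbitrary κ."*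
(The unsubscripted Δ^{(1),L} of the third term is the whole-lattice operator (2.27) p. 562 with C^{(0)} in place of
C^{(0)}_{Λ₅}: *"⟨ψ, Δ^{(k+1),L}_Λ(Ω, A)ψ⟩ = aL^{d−2} Σ_{y∈Λ′} |ψ(y)|² − a²L⁻⁴⟨ψ, Q(A)C^{(k)}_Λ(Ω, A)Q*(A)ψ⟩"*.)  The inputs,
part I Prop. 2.3 p. 611, verbatim: *"|C^{(k)}_Λ(Ω, A; x, x′)| ≦ c₀exp(−δ₀|x − x′|), x, x′ ∈ Λ. (2.34) … Putting δC^{(k)}_Λ(Ω, A) =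
C^{(k)}_Λ(Ω, A) − C^{(k)}(Ω, A), (2.35) we have |δC^{(k)}_Λ(Ω, A; x, x′)| ≦ c₀exp(−δ₀(|x − x′| + dist(x, Λᶜ) + dist(x′, Λᶜ))),
x, x′ ∈ Λ. (2.36)"*; the geometry (2.8) p. 558: *"Λ_{i+1}ᶜ is the sum of all large blocks of T₁ with distances from the set
Λ_iᶜ less or equal r(ε)"*, r(ε) = R(1 + log ε⁻¹)^r (2.7); the thresholds (2.17): |B| ≦ p(ε)/(μ₀ε) on the small-field blocks.

THE ARGUMENT (the print gives none; this is the evident one).  Write `B = B_o + B_i`, `B_o = Λ′₆ᶜB`, `B_i = Λ′₆B`; `Δ₅ :=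
Δ^{(1),L}_{Λ₅}` is symmetric, so `½⟨B,Δ₅B⟩ = ½⟨B_o,Δ₅B_o⟩ + ⟨B_o,Δ₅B_i⟩ + ½⟨B_i,Δ₅B_i⟩`.  Cross term: the diagonal part
`aL^{d−2}Σ_{Λ′₅}B_oB_i` vanishes (disjoint supports); in `−c²⟨B_o, QC_{Λ₅}Q*B_i⟩` the vector `C_{Λ₅}Q*B_i` lives on `Λ₅`, whose
blocks are `Λ′₅`, so `B_o` may be replaced by `(Λ′₅∩Λ′₆ᶜ)B`; and `B_i = (Λ′₆∩Λ′₇ᶜ)B + Λ′₇B`, the `Λ′₇B` part being FAR (blocks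
of `Λ′₅∖Λ′₆` against blocks of `Λ′₇`: distance `> r(ε)` by (2.8)) — first error term, `O(e^{−½δ₀r(ε)})·(p(ε)/μ₀ε)²·|Λ′₅|` by
(I.2.34).  Third term: `½⟨B_i,Δ₅B_i⟩ − ½⟨B_i,ΔB_i⟩ = −½c²⟨B_i, Q(C_{Λ₅} − C)Q*B_i⟩` (the diagonal parts agree on `Λ′₆ ⊆ Λ′₅`),
and `Q*B_i`, `QᵀB_i` live on the blocks of `Λ′₆`, at depth `> r(ε)` inside `Λ₅` — second error term by (I.2.36).  Both are
`O(ε^κ)|Λ′₅|` for every κ since `e^{−a·r(ε)}` beats any power of the thresholds ((2.109), `rDecayBeatsPowers`).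

DICTIONARY = part 1's (r02's `…B2Eq224FirstStepFields` plain real coordinates): `Q : Matrix Y X ℝ` ↤ `Q`, `Qs = w•Qᵀ` ↤ `Q*`
(`w` ↤ `L^d`, `⟨u,Kv⟩_{T′₁} = w·(u ⬝ᵥ Kv)`), `c` ↤ `aL⁻²`, `Λ` ↤ `Λ₅`, `Λ' ⊇ Λ₆' ⊇ Λ₇'` ↤ `Λ′₅ ⊇ Λ′₆ ⊇ Λ′₇`, `CΛ` ↤ `C^{(0)}_{Λ₅}`
(zero-extended, symmetric), `C` ↤ `C^{(0)}`, `restrict S B` ↤ `SB`; `d` ↤ `|x − x′|`, `u` ↤ `dist(·, Λ₅ᶜ)`; decay shapes `hK`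
(I.2.34), `hδC` (I.2.36, on `Λ₅ × Λ₅` as printed); separation `hsep` (blocks of `Λ′₅∖Λ′₆` vs blocks of `Λ′₇`) and depth `hdeep`
(blocks of `Λ′₆` inside `Λ₅`) ↤ (2.8); `q₁`, `qs₁` ↤ row-sum bounds of `Q`, `Q*`; `Ssum` ↤ `sup_xΣ_{x″}e^{−½δ₀|x−x″|}`.

WHAT IS KERNEL-CHECKED (zero `sorry`, standard axioms, no definitions).
 §3 `delta227_transpose` (Δ^{(1),L}_Λ symmetric), `half_form_split`, `dot_delta227_mulVec` (the bilinear form of (2.27)),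
    `sum_out_mul_in_eq_zero`, `dot_Q_covΛ_eq_restrict` (the `Λ′₅∩`), `restrict_out_eq`, `restrict_split`, `form_delta_diff` —
    whence **`eq237_exact`**: `½w⟨B,Δ₅B⟩ = ½w⟨Λ′₆ᶜB,Δ₅Λ′₆ᶜB⟩ − c²w⟨(Λ′₅∩Λ′₆ᶜ)B, QC_{Λ₅}Q*(Λ′₆∩Λ′₇ᶜ)B⟩ + ½w⟨Λ′₆B, ΔΛ′₆B⟩ +
    (far − δC)` EXACTLY;
 §4 **`eq237_far_bound`**, **`eq237_damped_bound`**, **`eq237_error_bound`** (`|far − δC| ≤ c²|w|·|Λ′₅|GBq₁·c₀e^{−½δ₀R}·qs₁GB·Ssum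
    + ½c²|w|·|Λ′₅|GBq₁·c₀e^{−δ₀R}·qs₁GB·Ssum`), **`eq237_error_pow`** (`≤ (3/2)c²|w|q₁qs₁c₀Ssum·C_κℓ^κ·|Λ′₅|` under the printed
    thresholds and `R ≥ r(ℓ)`).
HONEST SCOPE.  As in part 1: operators are data carrying the printed structural facts as hypotheses; the decay shapes and
the separation/depth of (2.8) are hypotheses in the printed form; nothing about the functional integral (2.33) is asserted.
-/

namespace Literature.MathematicalPhysics.QuantumFieldTheory.Balaban1983to89.B2Eq237FormSplit

open Real Matrix
open B2Eq218Translation (restrict)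
open B2Eq224FirstStepFields (delta227)
open B2Eq236Replacements (bilin_far_bound bilin_damped_bound pFn_nonneg abs_Qs_restrict_le exists_of_Qs_restrict_ne_zero)

/-! ## §3 **(2.37)**: splitting `½⟨B, Δ^{(1),L}_{Λ₅}B⟩` along `B = Λ′₆ᶜB + Λ′₆B` -/

section Form

variable {X Y : Type*} [Fintype X] [Fintype Y] [DecidableEq X] [DecidableEq Y]

omit [DecidableEq X] in
/-- `Δ^{(1),L}_Λ = aL⁻²χ_{Λ′} − a²L⁻⁴QC^{(0)}_ΛQ*` is symmetric for the scalar product of `T′₁` (`Q* = L^dQᵀ`, `C^{(0)}_Λ`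
symmetric). [cite: Balaban1982Higgs2, (2.27) p.562] -/
theorem delta227_transpose {w : ℝ} {Q : Matrix Y X ℝ} {Qs : Matrix X Y ℝ} {CΛ : Matrix X X ℝ} (hQs : Qs = w • Qᵀ)
    (hC : CΛᵀ = CΛ) (c : ℝ) (Λ' : Finset Y) : (delta227 c Λ' Q CΛ Qs)ᵀ = delta227 c Λ' Q CΛ Qs := by
  unfold delta227
  rw [Matrix.transpose_sub, Matrix.transpose_smul, Matrix.transpose_smul, Matrix.diagonal_transpose,
    Matrix.transpose_mul, Matrix.transpose_mul, hC, hQs, Matrix.transpose_smul, Matrix.transpose_transpose,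
    Matrix.smul_mul, Matrix.mul_smul, Matrix.mul_assoc]

omit [Fintype X] [DecidableEq X] [DecidableEq Y] in
/-- Polarization for a symmetric operator: `½⟨u+v, M(u+v)⟩ = ½⟨u, Mu⟩ + ⟨u, Mv⟩ + ½⟨v, Mv⟩`.
[folklore] [cite: Balaban1982Higgs2, (2.37) p.565] -/
theorem half_form_split {M : Matrix Y Y ℝ} (hM : Mᵀ = M) (u v : Y → ℝ) :
    1 / 2 * ((u + v) ⬝ᵥ (M *ᵥ (u + v)))
      = 1 / 2 * (u ⬝ᵥ (M *ᵥ u)) + u ⬝ᵥ (M *ᵥ v) + 1 / 2 * (v ⬝ᵥ (M *ᵥ v)) := by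
  rw [Matrix.mulVec_add, add_dotProduct, dotProduct_add, dotProduct_add,
    B2Eq224FirstStepFields.dot_mulVec_comm hM v u]
  ring

omit [DecidableEq X] in
/-- The bilinear form of (2.27): `⟨u, Δ^{(1),L}_Λ v⟩ = c·Σ_{y∈Λ′}u(y)v(y) − c²·⟨u, QC_ΛQ*v⟩`.
[cite: Balaban1982Higgs2, (2.27) p.562] -/
theorem dot_delta227_mulVec (c : ℝ) (Λ' : Finset Y) (Q : Matrix Y X ℝ) (CΛ : Matrix X X ℝ) (Qs : Matrix X Y ℝ)
    (u v : Y → ℝ) :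
    u ⬝ᵥ (delta227 c Λ' Q CΛ Qs *ᵥ v)
      = c * ∑ y ∈ Λ', u y * v y - c ^ 2 * (u ⬝ᵥ (Q *ᵥ (CΛ *ᵥ (Qs *ᵥ v)))) := by
  have hdiag : u ⬝ᵥ (Matrix.diagonal (fun y => if y ∈ Λ' then (1 : ℝ) else 0) *ᵥ v) = ∑ y ∈ Λ', u y * v y := by
    simp only [dotProduct, Matrix.mulVec_diagonal]
    rw [← Fintype.sum_ite_mem Λ']
    exact Finset.sum_congr rfl fun y _ => by split_ifs <;> ring
  simp only [delta227, Matrix.sub_mulVec, Matrix.smul_mulVec, dotProduct_sub, dotProduct_smul, smul_eq_mul, hdiag,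
    ← Matrix.mulVec_mulVec]

omit [Fintype X] [Fintype Y] [DecidableEq X] in
/-- `Λ′₆ᶜB` and `Λ′₆B` have disjoint supports: the diagonal part `aL⁻²χ_{Λ′₅}` of the cross term vanishes.
[cite: Balaban1982Higgs2, (2.37) p.565] -/
theorem sum_out_mul_in_eq_zero (Λ' Λ₆' : Finset Y) (B : Y → ℝ) :
    ∑ y ∈ Λ', (B - restrict Λ₆' B) y * restrict Λ₆' B y = 0 := by
  refine Finset.sum_eq_zero fun y _ => ?_
  simp only [Pi.sub_apply, restrict]
  split_ifs <;> ring

omit [DecidableEq X] in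
/-- Dirichlet support: `⟨u, QC^{(0)}_{Λ₅}v⟩ = ⟨Λ′₅u, QC^{(0)}_{Λ₅}v⟩` (`C^{(0)}_{Λ₅}v` lives on `Λ₅`, whose blocks are `Λ′₅`) —
the `Λ′₅ ∩` of the printed second term. [cite: Balaban1982Higgs2, (2.37) p.565] -/
theorem dot_Q_covΛ_eq_restrict {Λ : Finset X} {Λ' : Finset Y} {Q : Matrix Y X ℝ} {CΛ : Matrix X X ℝ}
    (hQ : ∀ y x, Q y x ≠ 0 → (x ∈ Λ ↔ y ∈ Λ')) (hCs : ∀ x x', CΛ x x' ≠ 0 → x ∈ Λ ∧ x' ∈ Λ)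
    (u : Y → ℝ) (v : X → ℝ) :
    u ⬝ᵥ (Q *ᵥ (CΛ *ᵥ v)) = restrict Λ' u ⬝ᵥ (Q *ᵥ (CΛ *ᵥ v)) := by
  unfold dotProduct
  refine Finset.sum_congr rfl fun y _ => ?_
  by_cases hy : y ∈ Λ'
  · rw [show restrict Λ' u y = u y from if_pos hy]
  · have h0 : (Q *ᵥ (CΛ *ᵥ v)) y = 0 := by
      change ∑ x, Q y x * (CΛ *ᵥ v) x = 0
      refine Finset.sum_eq_zero fun x _ => ?_
      by_cases hQ0 : Q y x = 0
      · rw [hQ0, zero_mul]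
      · have hx : x ∉ Λ := fun hx => hy ((hQ y x hQ0).1 hx)
        rw [B2Eq224FirstStepFields.covΛ_mulVec_eq_zero hCs hx, mul_zero]
    rw [h0, mul_zero, mul_zero]

omit [Fintype X] [Fintype Y] [DecidableEq X] in
/-- `Λ′₅(Λ′₆ᶜB) = (Λ′₅ ∩ Λ′₆ᶜ)B`. [cite: Balaban1982Higgs2, (2.37) p.565] -/
theorem restrict_out_eq (Λ' Λ₆' : Finset Y) (B : Y → ℝ) :
    restrict Λ' (B - restrict Λ₆' B) = restrict (Λ' \ Λ₆') B := by
  funext y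
  simp only [restrict, Pi.sub_apply, Finset.mem_sdiff]
  by_cases h1 : y ∈ Λ' <;> by_cases h2 : y ∈ Λ₆' <;> simp [h1, h2]

omit [Fintype X] [Fintype Y] [DecidableEq X] in
/-- `Λ′₆B = (Λ′₆ ∩ Λ′₇ᶜ)B + Λ′₇B` for `Λ′₇ ⊆ Λ′₆`. [cite: Balaban1982Higgs2, (2.37) p.565] -/
theorem restrict_split {Λ₆' Λ₇' : Finset Y} (h7 : Λ₇' ⊆ Λ₆') (B : Y → ℝ) :
    restrict Λ₆' B = restrict (Λ₆' \ Λ₇') B + restrict Λ₇' B := by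
  funext y
  simp only [restrict, Pi.add_apply, Finset.mem_sdiff]
  by_cases h1 : y ∈ Λ₆'
  · by_cases h2 : y ∈ Λ₇' <;> simp [h1, h2]
  · have h2 : y ∉ Λ₇' := fun h => h1 (h7 h)
    simp [h1, h2]

omit [DecidableEq X] in
/-- Third term: on `Λ′₆B` (`Λ′₆ ⊆ Λ′₅`) the forms of `Δ^{(1),L}_{Λ₅}` and of the whole-lattice `Δ^{(1),L}` differ exactly by
`−c²⟨Λ′₆B, Q(C^{(0)}_{Λ₅} − C^{(0)})Q*Λ′₆B⟩` (the diagonal parts agree). [cite: Balaban1982Higgs2, (2.37) p.565] -/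
theorem form_delta_diff (c : ℝ) {Λ' Λ₆' : Finset Y} (h6 : Λ₆' ⊆ Λ') (Q : Matrix Y X ℝ) (CΛ C : Matrix X X ℝ)
    (Qs : Matrix X Y ℝ) (B : Y → ℝ) :
    restrict Λ₆' B ⬝ᵥ (delta227 c Λ' Q CΛ Qs *ᵥ restrict Λ₆' B)
      = restrict Λ₆' B ⬝ᵥ (delta227 c Finset.univ Q C Qs *ᵥ restrict Λ₆' B)
        - c ^ 2 * (restrict Λ₆' B ⬝ᵥ (Q *ᵥ ((CΛ - C) *ᵥ (Qs *ᵥ restrict Λ₆' B)))) := by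
  rw [dot_delta227_mulVec, dot_delta227_mulVec]
  have hd : ∑ y ∈ Λ', restrict Λ₆' B y * restrict Λ₆' B y = ∑ y ∈ Finset.univ, restrict Λ₆' B y * restrict Λ₆' B y := by
    apply Finset.sum_subset (Finset.subset_univ _)
    intro y _ hy
    have hy6 : y ∉ Λ₆' := fun h => hy (h6 h)
    rw [show restrict Λ₆' B y = 0 from if_neg hy6, mul_zero]
  rw [hd, Matrix.sub_mulVec, Matrix.mulVec_sub, dotProduct_sub]
  ring

omit [DecidableEq X] in
/-- **(2.37), EXACT form** (everything but the `O(ε^κ)|Λ′₅|`, which is displayed): with `Λ′₆ᶜB := B − Λ′₆B`,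
`½·L^d⟨B, Δ^{(1),L}_{Λ₅}B⟩ = ½·L^d⟨Λ′₆ᶜB, Δ^{(1),L}_{Λ₅}Λ′₆ᶜB⟩ − c²·L^d⟨(Λ′₅∩Λ′₆ᶜ)B, QC^{(0)}_{Λ₅}Q*(Λ′₆∩Λ′₇ᶜ)B⟩
 + ½·L^d⟨Λ′₆B, Δ^{(1),L}Λ′₆B⟩ + ( −c²·L^d⟨(Λ′₅∩Λ′₆ᶜ)B, QC^{(0)}_{Λ₅}Q*Λ′₇B⟩ − ½c²·L^d⟨Λ′₆B, Q(C^{(0)}_{Λ₅} − C^{(0)})Q*Λ′₆B⟩ )`,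
the last bracket being the printed `O(ε^κ)|Λ′₅|` (`eq237_error_bound`).  Hypotheses: `Q* = L^dQᵀ`, `C^{(0)}_{Λ₅}` symmetric
with Dirichlet support, the block structure of `Λ₅`/`Λ′₅`, `Λ′₇ ⊆ Λ′₆ ⊆ Λ′₅`. [cite: Balaban1982Higgs2, (2.37) p.565] -/
theorem eq237_exact {c w : ℝ} {Λ : Finset X} {Λ' Λ₆' Λ₇' : Finset Y} {Q : Matrix Y X ℝ} {Qs : Matrix X Y ℝ}
    {CΛ : Matrix X X ℝ} (hQs : Qs = w • Qᵀ) (hC : CΛᵀ = CΛ)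
    (hQ : ∀ y x, Q y x ≠ 0 → (x ∈ Λ ↔ y ∈ Λ')) (hCs : ∀ x x', CΛ x x' ≠ 0 → x ∈ Λ ∧ x' ∈ Λ)
    (h6 : Λ₆' ⊆ Λ') (h7 : Λ₇' ⊆ Λ₆') (C : Matrix X X ℝ) (B : Y → ℝ) :
    1 / 2 * (w * (B ⬝ᵥ (delta227 c Λ' Q CΛ Qs *ᵥ B)))
      = 1 / 2 * (w * ((B - restrict Λ₆' B) ⬝ᵥ (delta227 c Λ' Q CΛ Qs *ᵥ (B - restrict Λ₆' B))))
        - c ^ 2 * (w * (restrict (Λ' \ Λ₆') B ⬝ᵥ (Q *ᵥ (CΛ *ᵥ (Qs *ᵥ restrict (Λ₆' \ Λ₇') B)))))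
        + 1 / 2 * (w * (restrict Λ₆' B ⬝ᵥ (delta227 c Finset.univ Q C Qs *ᵥ restrict Λ₆' B)))
        + (-(c ^ 2 * (w * (restrict (Λ' \ Λ₆') B ⬝ᵥ (Q *ᵥ (CΛ *ᵥ (Qs *ᵥ restrict Λ₇' B))))))
          - 1 / 2 * c ^ 2 * (w * (restrict Λ₆' B ⬝ᵥ (Q *ᵥ ((CΛ - C) *ᵥ (Qs *ᵥ restrict Λ₆' B)))))) := by
  have hsym := delta227_transpose hQs hC c Λ'
  have hsplit : 1 / 2 * (B ⬝ᵥ (delta227 c Λ' Q CΛ Qs *ᵥ B))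
      = 1 / 2 * ((B - restrict Λ₆' B) ⬝ᵥ (delta227 c Λ' Q CΛ Qs *ᵥ (B - restrict Λ₆' B)))
        + (B - restrict Λ₆' B) ⬝ᵥ (delta227 c Λ' Q CΛ Qs *ᵥ restrict Λ₆' B)
        + 1 / 2 * (restrict Λ₆' B ⬝ᵥ (delta227 c Λ' Q CΛ Qs *ᵥ restrict Λ₆' B)) := by
    have h := half_form_split hsym (B - restrict Λ₆' B) (restrict Λ₆' B)
    rwa [sub_add_cancel] at h
  have hcross : (B - restrict Λ₆' B) ⬝ᵥ (delta227 c Λ' Q CΛ Qs *ᵥ restrict Λ₆' B)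
      = -(c ^ 2 * (restrict (Λ' \ Λ₆') B ⬝ᵥ (Q *ᵥ (CΛ *ᵥ (Qs *ᵥ restrict (Λ₆' \ Λ₇') B)))))
        - c ^ 2 * (restrict (Λ' \ Λ₆') B ⬝ᵥ (Q *ᵥ (CΛ *ᵥ (Qs *ᵥ restrict Λ₇' B)))) := by
    rw [dot_delta227_mulVec, sum_out_mul_in_eq_zero, mul_zero, zero_sub, dot_Q_covΛ_eq_restrict hQ hCs,
      restrict_out_eq, restrict_split h7 B, Matrix.mulVec_add, Matrix.mulVec_add, Matrix.mulVec_add, dotProduct_add]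
    ring
  have hdiff := form_delta_diff c h6 Q CΛ C Qs B
  have h0 : 1 / 2 * (w * (B ⬝ᵥ (delta227 c Λ' Q CΛ Qs *ᵥ B))) = w * (1 / 2 * (B ⬝ᵥ (delta227 c Λ' Q CΛ Qs *ᵥ B))) := by
    ring
  rw [h0, hsplit, hcross, hdiff]
  ring

end Form

/-! ## §4 **(2.37)**: the error `O(ε^κ)|Λ′₅|` — a far term ((I.2.34) + (2.8)) and a `δC` term ((I.2.36)) -/

section Error

variable {X Y : Type*} [Fintype X] [Fintype Y] [DecidableEq Y]

omit [DecidableEq Y] in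
/-- `⟨u, QKg⟩ = Σ_xΣ_{x″} (Σ_y u(y)Q(y,x))·K(x,x″)·g(x″)` — a bilinear kernel sum in the fine variables.
[folklore] [cite: Balaban1982Higgs2, (2.37) p.565] -/
theorem dot_Q_K_eq_sum (u : Y → ℝ) (Q : Matrix Y X ℝ) (K : Matrix X X ℝ) (g : X → ℝ) :
    u ⬝ᵥ (Q *ᵥ (K *ᵥ g)) = ∑ x, ∑ x'', (∑ y, u y * Q y x) * K x x'' * g x'' := by
  rw [Matrix.dotProduct_mulVec]
  unfold dotProduct
  refine Finset.sum_congr rfl fun x _ => ?_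
  change (∑ y, u y * Q y x) * ∑ x'', K x x'' * g x'' = _
  rw [Finset.mul_sum]
  exact Finset.sum_congr rfl fun _ _ => by ring

omit [DecidableEq Y] in
/-- `Σ_x|Σ_y u(y)Q(y,x)| ≤ (Σ_y|u(y)|)·q₁` for the row-sum bound `Σ_x|Q(y,x)| ≤ q₁`. [folklore]
[cite: Balaban1982Higgs2, (2.37) p.565] -/
theorem sum_abs_vecMul_le {u : Y → ℝ} {Q : Matrix Y X ℝ} {q₁ : ℝ} (hQ1 : ∀ y, ∑ x, |Q y x| ≤ q₁) :
    ∑ x, |∑ y, u y * Q y x| ≤ (∑ y, |u y|) * q₁ := by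
  calc ∑ x, |∑ y, u y * Q y x| ≤ ∑ x, ∑ y, |u y| * |Q y x| :=
        Finset.sum_le_sum fun x _ =>
          (Finset.abs_sum_le_sum_abs _ _).trans (le_of_eq (Finset.sum_congr rfl fun y _ => abs_mul _ _))
    _ = ∑ y, |u y| * ∑ x, |Q y x| := by
        rw [Finset.sum_comm]
        exact Finset.sum_congr rfl fun y _ => by rw [Finset.mul_sum]
    _ ≤ ∑ y, |u y| * q₁ := Finset.sum_le_sum fun y _ => mul_le_mul_of_nonneg_left (hQ1 y) (abs_nonneg _)
    _ = (∑ y, |u y|) * q₁ := by rw [Finset.sum_mul]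

omit [Fintype X] in
/-- `Σ_y|(SB)(y)| ≤ |Λ′₅|·GB` for `S ⊆ Λ′₅` and `|B| ≤ GB` on `Λ′₅`. [folklore] [cite: Balaban1982Higgs2, (2.17) p.560] -/
theorem sum_abs_restrict_le {S Λ' : Finset Y} {B : Y → ℝ} {GB : ℝ} (hS : S ⊆ Λ') (hGB : 0 ≤ GB)
    (hB : ∀ y ∈ Λ', |B y| ≤ GB) : ∑ y, |restrict S B y| ≤ Λ'.card * GB := by
  calc ∑ y, |restrict S B y| ≤ ∑ y, (if y ∈ Λ' then GB else 0) := Finset.sum_le_sum fun y _ => by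
          unfold restrict
          by_cases h1 : y ∈ S
          · rw [if_pos h1, if_pos (hS h1)]
            exact hB y (hS h1)
          · rw [if_neg h1, abs_zero]
            split_ifs
            · exact hGB
            · exact le_rfl
    _ = Λ'.card * GB := by rw [Fintype.sum_ite_mem Λ', Finset.sum_const, nsmul_eq_mul]

omit [Fintype X] in
/-- A fine point `x` with `Σ_y (SB)(y)Q(y,x) ≠ 0` lies in a block of `S`. [folklore] [cite: Balaban1982Higgs2, (2.37) p.565] -/
theorem exists_of_vecMul_restrict_ne_zero {S : Finset Y} {B : Y → ℝ} {Q : Matrix Y X ℝ} {x : X}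
    (h : (∑ y, restrict S B y * Q y x) ≠ 0) : ∃ y ∈ S, Q y x ≠ 0 := by
  obtain ⟨y, -, hy⟩ := Finset.exists_ne_zero_of_sum_ne_zero h
  have hyQ : Q y x ≠ 0 := fun h0 => hy (by rw [h0, mul_zero])
  refine ⟨y, ?_, hyQ⟩
  by_contra hyS
  apply hy
  rw [show restrict S B y = 0 from if_neg hyS, zero_mul]

/-- **(2.37), the far part of the error**: `|c²·L^d⟨(Λ′₅∩Λ′₆ᶜ)B, QC^{(0)}_{Λ₅}Q*Λ′₇B⟩| ≤
c²|L^d|·(|Λ′₅|·GB·q₁)·c₀e^{−½δ₀R}·(qs₁GB)·Ssum` — (I.2.34) for `C^{(0)}_{Λ₅}` and the separation `R` between the blocks of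
`Λ′₅∖Λ′₆` and those of `Λ′₇` ((2.8), twice `r(ε)`). [cite: Balaban1982Higgs2, (2.37) p.565] -/
theorem eq237_far_bound {c w : ℝ} {Λ' Λ₆' Λ₇' : Finset Y} {Q : Matrix Y X ℝ} {Qs : Matrix X Y ℝ} {CΛ : Matrix X X ℝ}
    {B : Y → ℝ} {d : X → X → ℝ} {c₀ δ R GB q₁ qs₁ Ssum : ℝ}
    (hc₀ : 0 ≤ c₀) (hδ : 0 ≤ δ) (hGB : 0 ≤ GB) (hq : 0 ≤ q₁) (hqs : 0 ≤ qs₁) (hS0 : 0 ≤ Ssum) (h6 : Λ₆' ⊆ Λ')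
    (h7 : Λ₇' ⊆ Λ₆') (hK : ∀ x x'', |CΛ x x''| ≤ c₀ * Real.exp (-(δ * d x x'')))
    (hB : ∀ y ∈ Λ', |B y| ≤ GB) (hQ1 : ∀ y, ∑ x, |Q y x| ≤ q₁) (hQs1 : ∀ x'', ∑ y, |Qs x'' y| ≤ qs₁)
    (hsep : ∀ x x'' y y', y ∈ Λ' → y ∉ Λ₆' → Q y x ≠ 0 → y' ∈ Λ₇' → Qs x'' y' ≠ 0 → R ≤ d x x'')
    (hS : ∀ x, ∑ x'', Real.exp (-(δ / 2 * d x x'')) ≤ Ssum) :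
    |c ^ 2 * (w * (restrict (Λ' \ Λ₆') B ⬝ᵥ (Q *ᵥ (CΛ *ᵥ (Qs *ᵥ restrict Λ₇' B)))))|
      ≤ c ^ 2 * |w| * ((Λ'.card * GB * q₁) * (c₀ * Real.exp (-(δ / 2 * R)) * (qs₁ * GB) * Ssum)) := by
  rw [abs_mul, abs_mul, abs_of_nonneg (sq_nonneg c), mul_assoc]
  refine mul_le_mul_of_nonneg_left (mul_le_mul_of_nonneg_left ?_ (abs_nonneg w)) (sq_nonneg c)
  rw [dot_Q_K_eq_sum]
  have hB7 : ∀ y ∈ Λ₇', |B y| ≤ GB := fun y hy => hB y (h6 (h7 hy))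
  have hF : ∑ x ∈ Finset.univ, |∑ y, restrict (Λ' \ Λ₆') B y * Q y x| ≤ Λ'.card * GB * q₁ :=
    (sum_abs_vecMul_le hQ1).trans (mul_le_mul_of_nonneg_right (sum_abs_restrict_le Finset.sdiff_subset hGB hB) hq)
  refine bilin_far_bound (S₁ := Finset.univ) (S₂ := Finset.univ) (f := fun x => ∑ y, restrict (Λ' \ Λ₆') B y * Q y x)
    (g := Qs *ᵥ restrict Λ₇' B) hc₀ hδ (mul_nonneg hqs hGB) hF (fun x _ x'' _ => hK x x'') ?_
    (fun x'' _ => abs_Qs_restrict_le hGB hB7 hQs1 x'') hS0 (fun x _ => hS x)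
  intro x _ x'' _ hf hg
  obtain ⟨y, hyS, hyQ⟩ := exists_of_vecMul_restrict_ne_zero hf
  obtain ⟨y', hy7, hy'Q⟩ := exists_of_Qs_restrict_ne_zero hg
  rw [Finset.mem_sdiff] at hyS
  exact hsep x x'' y y' hyS.1 hyS.2 hyQ hy7 hy'Q

/-- **(2.37), the `δC` part of the error**: `|½c²·L^d⟨Λ′₆B, Q(C^{(0)}_{Λ₅} − C^{(0)})Q*Λ′₆B⟩| ≤
½c²|L^d|·(|Λ′₅|·GB·q₁)·c₀e^{−δ₀R}·(qs₁GB)·Ssum` — the fine sums live on `Λ₅ × Λ₅` (the blocks of `Λ′₆ ⊆ Λ′₅` are in `Λ₅`),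
where (I.2.36) holds, and the blocks of `Λ′₆` are deeper than `R` inside `Λ₅` ((2.8)). [cite: Balaban1982Higgs2, (2.37) p.565] -/
theorem eq237_damped_bound {c w : ℝ} {Λ : Finset X} {Λ' Λ₆' : Finset Y} {Q : Matrix Y X ℝ} {Qs : Matrix X Y ℝ}
    {CΛ C : Matrix X X ℝ} {B : Y → ℝ} {d : X → X → ℝ} {u : X → ℝ} {c₀ δ R GB q₁ qs₁ Ssum : ℝ}
    (hc₀ : 0 ≤ c₀) (hδ : 0 ≤ δ) (hGB : 0 ≤ GB) (hq : 0 ≤ q₁) (hqs : 0 ≤ qs₁) (hS0 : 0 ≤ Ssum) (h6 : Λ₆' ⊆ Λ')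
    (hQs : Qs = w • Qᵀ) (hQ : ∀ y x, Q y x ≠ 0 → (x ∈ Λ ↔ y ∈ Λ'))
    (hδC : ∀ x ∈ Λ, ∀ x'' ∈ Λ, |CΛ x x'' - C x x''| ≤ c₀ * Real.exp (-(δ * (d x x'' + u x + u x''))))
    (hd : ∀ x x'', 0 ≤ d x x'') (hu : ∀ x, 0 ≤ u x) (hdeep : ∀ y ∈ Λ₆', ∀ x, Q y x ≠ 0 → R ≤ u x)
    (hB : ∀ y ∈ Λ', |B y| ≤ GB) (hQ1 : ∀ y, ∑ x, |Q y x| ≤ q₁) (hQs1 : ∀ x'', ∑ y, |Qs x'' y| ≤ qs₁)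
    (hS : ∀ x, ∑ x'', Real.exp (-(δ / 2 * d x x'')) ≤ Ssum) :
    |1 / 2 * c ^ 2 * (w * (restrict Λ₆' B ⬝ᵥ (Q *ᵥ ((CΛ - C) *ᵥ (Qs *ᵥ restrict Λ₆' B)))))|
      ≤ 1 / 2 * c ^ 2 * |w| * ((Λ'.card * GB * q₁) * (c₀ * Real.exp (-(δ * R)) * (qs₁ * GB) * Ssum)) := by
  suffices hX : |restrict Λ₆' B ⬝ᵥ (Q *ᵥ ((CΛ - C) *ᵥ (Qs *ᵥ restrict Λ₆' B)))|
      ≤ (Λ'.card * GB * q₁) * (c₀ * Real.exp (-(δ * R)) * (qs₁ * GB) * Ssum) by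
    calc |1 / 2 * c ^ 2 * (w * (restrict Λ₆' B ⬝ᵥ (Q *ᵥ ((CΛ - C) *ᵥ (Qs *ᵥ restrict Λ₆' B)))))|
        = 1 / 2 * c ^ 2 * |w| * |restrict Λ₆' B ⬝ᵥ (Q *ᵥ ((CΛ - C) *ᵥ (Qs *ᵥ restrict Λ₆' B)))| := by
          rw [abs_mul, abs_mul, abs_mul, abs_of_nonneg (by norm_num : (0 : ℝ) ≤ 1 / 2), abs_of_nonneg (sq_nonneg c)]
          ring
      _ ≤ 1 / 2 * c ^ 2 * |w| * ((Λ'.card * GB * q₁) * (c₀ * Real.exp (-(δ * R)) * (qs₁ * GB) * Ssum)) :=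
          mul_le_mul_of_nonneg_left hX (by positivity)
  rw [dot_Q_K_eq_sum]
  have hB6 : ∀ y ∈ Λ₆', |B y| ≤ GB := fun y hy => hB y (h6 hy)
  have hf0 : ∀ x, x ∉ Λ → (∑ y, restrict Λ₆' B y * Q y x) = 0 := by
    intro x hx
    refine Finset.sum_eq_zero fun y _ => ?_
    by_cases hQ0 : Q y x = 0
    · rw [hQ0, mul_zero]
    · by_cases hy6 : y ∈ Λ₆'
      · exact absurd ((hQ y x hQ0).2 (h6 hy6)) hx
      · rw [show restrict Λ₆' B y = 0 from if_neg hy6, zero_mul]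
  have hg0 : ∀ x'', x'' ∉ Λ → (Qs *ᵥ restrict Λ₆' B) x'' = 0 := by
    intro x'' hx''
    change ∑ y, Qs x'' y * restrict Λ₆' B y = 0
    refine Finset.sum_eq_zero fun y _ => ?_
    by_cases hy6 : y ∈ Λ₆'
    · have hQ0 : Q y x'' = 0 := by
        by_contra hQ0
        exact hx'' ((hQ y x'' hQ0).2 (h6 hy6))
      rw [hQs, Matrix.smul_apply, Matrix.transpose_apply, hQ0, smul_zero, zero_mul]
    · rw [show restrict Λ₆' B y = 0 from if_neg hy6, mul_zero]
  have hrestrict : ∑ x, ∑ x'', (∑ y, restrict Λ₆' B y * Q y x) * (CΛ - C) x x'' * (Qs *ᵥ restrict Λ₆' B) x''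
      = ∑ x ∈ Λ, ∑ x'' ∈ Λ, (∑ y, restrict Λ₆' B y * Q y x) * (CΛ - C) x x'' * (Qs *ᵥ restrict Λ₆' B) x'' := by
    symm
    refine (Finset.sum_subset (Finset.subset_univ Λ) fun x _ hx => ?_).trans
      (Finset.sum_congr rfl fun x _ => Finset.sum_subset (Finset.subset_univ Λ) fun x'' _ hx'' => ?_)
    · exact Finset.sum_eq_zero fun x'' _ => by rw [hf0 x hx, zero_mul, zero_mul]
    · rw [hg0 x'' hx'', mul_zero]
  rw [hrestrict]
  have hF : ∑ x ∈ Λ, |∑ y, restrict Λ₆' B y * Q y x| ≤ Λ'.card * GB * q₁ :=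
    calc ∑ x ∈ Λ, |∑ y, restrict Λ₆' B y * Q y x| ≤ ∑ x, |∑ y, restrict Λ₆' B y * Q y x| :=
          Finset.sum_le_sum_of_subset_of_nonneg (Finset.subset_univ Λ) fun _ _ _ => abs_nonneg _
      _ ≤ (∑ y, |restrict Λ₆' B y|) * q₁ := sum_abs_vecMul_le hQ1
      _ ≤ Λ'.card * GB * q₁ := mul_le_mul_of_nonneg_right (sum_abs_restrict_le h6 hGB hB) hq
  have hSΛ : ∀ x ∈ Λ, ∑ x'' ∈ Λ, Real.exp (-(δ / 2 * d x x'')) ≤ Ssum := fun x _ =>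
    (Finset.sum_le_sum_of_subset_of_nonneg (Finset.subset_univ Λ) fun _ _ _ => (Real.exp_pos _).le).trans (hS x)
  refine bilin_damped_bound (S₁ := Λ) (S₂ := Λ) (f := fun x => ∑ y, restrict Λ₆' B y * Q y x)
    (g := Qs *ᵥ restrict Λ₆' B) (Dk := fun x x'' => (CΛ - C) x x'') hc₀ hδ (mul_nonneg hqs hGB) hF ?_ ?_
    (fun x' _ => hu x') (fun x _ x'' _ => hd x x'') (fun x'' _ => abs_Qs_restrict_le hGB hB6 hQs1 x'') hS0 hSΛ
  · intro x hx x'' hx''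
    rw [Matrix.sub_apply]
    exact hδC x hx x'' hx''
  · intro x _ hfx
    obtain ⟨y, hy6, hyQ⟩ := exists_of_vecMul_restrict_ne_zero hfx
    exact hdeep y hy6 x hyQ

/-- **(2.37), the error bound**: `|[far term] − [δC term]| ≤ c²|L^d|·|Λ′₅|GBq₁·c₀e^{−½δ₀R}·qs₁GB·Ssum +
½c²|L^d|·|Λ′₅|GBq₁·c₀e^{−δ₀R}·qs₁GB·Ssum` — the printed `O(ε^κ)|Λ′₅|` with its constants.
[cite: Balaban1982Higgs2, (2.37) p.565] -/
theorem eq237_error_bound {c w : ℝ} {Λ : Finset X} {Λ' Λ₆' Λ₇' : Finset Y} {Q : Matrix Y X ℝ} {Qs : Matrix X Y ℝ}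
    {CΛ C : Matrix X X ℝ} {B : Y → ℝ} {d : X → X → ℝ} {u : X → ℝ} {c₀ δ R GB q₁ qs₁ Ssum : ℝ}
    (hc₀ : 0 ≤ c₀) (hδ : 0 ≤ δ) (hGB : 0 ≤ GB) (hq : 0 ≤ q₁) (hqs : 0 ≤ qs₁) (hS0 : 0 ≤ Ssum) (h6 : Λ₆' ⊆ Λ')
    (h7 : Λ₇' ⊆ Λ₆') (hQs : Qs = w • Qᵀ) (hQ : ∀ y x, Q y x ≠ 0 → (x ∈ Λ ↔ y ∈ Λ'))
    (hK : ∀ x x'', |CΛ x x''| ≤ c₀ * Real.exp (-(δ * d x x'')))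
    (hδC : ∀ x ∈ Λ, ∀ x'' ∈ Λ, |CΛ x x'' - C x x''| ≤ c₀ * Real.exp (-(δ * (d x x'' + u x + u x''))))
    (hd : ∀ x x'', 0 ≤ d x x'') (hu : ∀ x, 0 ≤ u x) (hdeep : ∀ y ∈ Λ₆', ∀ x, Q y x ≠ 0 → R ≤ u x)
    (hsep : ∀ x x'' y y', y ∈ Λ' → y ∉ Λ₆' → Q y x ≠ 0 → y' ∈ Λ₇' → Qs x'' y' ≠ 0 → R ≤ d x x'')
    (hB : ∀ y ∈ Λ', |B y| ≤ GB) (hQ1 : ∀ y, ∑ x, |Q y x| ≤ q₁) (hQs1 : ∀ x'', ∑ y, |Qs x'' y| ≤ qs₁)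
    (hS : ∀ x, ∑ x'', Real.exp (-(δ / 2 * d x x'')) ≤ Ssum) :
    |(-(c ^ 2 * (w * (restrict (Λ' \ Λ₆') B ⬝ᵥ (Q *ᵥ (CΛ *ᵥ (Qs *ᵥ restrict Λ₇' B)))))))
        - 1 / 2 * c ^ 2 * (w * (restrict Λ₆' B ⬝ᵥ (Q *ᵥ ((CΛ - C) *ᵥ (Qs *ᵥ restrict Λ₆' B)))))|
      ≤ c ^ 2 * |w| * ((Λ'.card * GB * q₁) * (c₀ * Real.exp (-(δ / 2 * R)) * (qs₁ * GB) * Ssum))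
        + 1 / 2 * c ^ 2 * |w| * ((Λ'.card * GB * q₁) * (c₀ * Real.exp (-(δ * R)) * (qs₁ * GB) * Ssum)) := by
  refine (abs_sub _ _).trans (add_le_add ?_ ?_)
  · rw [abs_neg]
    exact eq237_far_bound hc₀ hδ hGB hq hqs hS0 h6 h7 hK hB hQ1 hQs1 hsep hS
  · exact eq237_damped_bound hc₀ hδ hGB hq hqs hS0 h6 hQs hQ hδC hd hu hdeep hB hQ1 hQs1 hS

omit [Fintype X] [Fintype Y] [DecidableEq Y] in
/-- `r(ℓ) = R(1 + log ℓ⁻¹)^r ≥ 0` on `(0,1]` for `R ≥ 0`. [cite: Balaban1982Higgs2, (2.7) p.558] -/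
theorem rFn_nonneg {Rr r ℓ : ℝ} (hR : 0 ≤ Rr) (hℓ : 0 < ℓ) (hℓ1 : ℓ ≤ 1) : 0 ≤ B2.rFn Rr r ℓ := by
  unfold B2.rFn
  have hlog : 0 ≤ Real.log ℓ⁻¹ := by
    rw [Real.log_inv]
    have := Real.log_nonpos hℓ.le hℓ1
    linarith
  exact mul_nonneg hR (Real.rpow_nonneg (by linarith) _)

/-- **(2.37), "for arbitrary κ"**: under the printed thresholds `|B| ≤ p(ℓ)/(μ₀ℓ)` on `Λ′₅`, the separation/depth
`R ≥ r(ℓ)` of (2.8) and the constant `C_κ` of `decay_thresholds_pow` (rate `½δ₀`), the error of (2.37) is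
`≤ (3/2)c²|L^d|q₁qs₁c₀·Ssum·C_κℓ^κ·|Λ′₅|` — *"O(ε^κ)|Λ′₅|"*. [cite: Balaban1982Higgs2, (2.37) p.565] -/
theorem eq237_error_pow {c w : ℝ} {Λ : Finset X} {Λ' Λ₆' Λ₇' : Finset Y} {Q : Matrix Y X ℝ} {Qs : Matrix X Y ℝ}
    {CΛ C : Matrix X X ℝ} {B : Y → ℝ} {d : X → X → ℝ} {u : X → ℝ}
    {c₀ δ R q₁ qs₁ Ssum b₀ p μ₀ Rr r ℓ κ Cκ : ℝ}
    (hc₀ : 0 ≤ c₀) (hδ : 0 ≤ δ) (hq : 0 ≤ q₁) (hqs : 0 ≤ qs₁) (hS0 : 0 ≤ Ssum) (hb : 0 ≤ b₀) (hμ₀ : 0 < μ₀)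
    (hRr0 : 0 ≤ Rr) (hℓ : 0 < ℓ) (hℓ1 : ℓ ≤ 1) (hRr : B2.rFn Rr r ℓ ≤ R)
    (hCκ : Real.exp (-(δ / 2 * B2.rFn Rr r ℓ)) * (B2.pFn b₀ p ℓ / (μ₀ * ℓ)) ^ 2 ≤ Cκ * ℓ ^ κ)
    (h6 : Λ₆' ⊆ Λ') (h7 : Λ₇' ⊆ Λ₆') (hQs : Qs = w • Qᵀ) (hQ : ∀ y x, Q y x ≠ 0 → (x ∈ Λ ↔ y ∈ Λ'))
    (hK : ∀ x x'', |CΛ x x''| ≤ c₀ * Real.exp (-(δ * d x x'')))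
    (hδC : ∀ x ∈ Λ, ∀ x'' ∈ Λ, |CΛ x x'' - C x x''| ≤ c₀ * Real.exp (-(δ * (d x x'' + u x + u x''))))
    (hd : ∀ x x'', 0 ≤ d x x'') (hu : ∀ x, 0 ≤ u x) (hdeep : ∀ y ∈ Λ₆', ∀ x, Q y x ≠ 0 → R ≤ u x)
    (hsep : ∀ x x'' y y', y ∈ Λ' → y ∉ Λ₆' → Q y x ≠ 0 → y' ∈ Λ₇' → Qs x'' y' ≠ 0 → R ≤ d x x'')
    (hB : ∀ y ∈ Λ', |B y| ≤ B2.pFn b₀ p ℓ / (μ₀ * ℓ)) (hQ1 : ∀ y, ∑ x, |Q y x| ≤ q₁)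
    (hQs1 : ∀ x'', ∑ y, |Qs x'' y| ≤ qs₁) (hS : ∀ x, ∑ x'', Real.exp (-(δ / 2 * d x x'')) ≤ Ssum) :
    |(-(c ^ 2 * (w * (restrict (Λ' \ Λ₆') B ⬝ᵥ (Q *ᵥ (CΛ *ᵥ (Qs *ᵥ restrict Λ₇' B)))))))
        - 1 / 2 * c ^ 2 * (w * (restrict Λ₆' B ⬝ᵥ (Q *ᵥ ((CΛ - C) *ᵥ (Qs *ᵥ restrict Λ₆' B)))))|
      ≤ 3 / 2 * c ^ 2 * |w| * q₁ * qs₁ * c₀ * Ssum * (Cκ * ℓ ^ κ) * Λ'.card := by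
  set t : ℝ := B2.pFn b₀ p ℓ / (μ₀ * ℓ) with ht
  have ht0 : 0 ≤ t := div_nonneg (pFn_nonneg hb hℓ hℓ1) (mul_pos hμ₀ hℓ).le
  have h1 := eq237_error_bound (c := c) (GB := t) hc₀ hδ ht0 hq hqs hS0 h6 h7 hQs hQ hK hδC hd hu hdeep hsep hB hQ1
    hQs1 hS
  have hR0 : 0 ≤ R := (rFn_nonneg hRr0 hℓ hℓ1).trans hRr
  have hexp : Real.exp (-(δ / 2 * R)) ≤ Real.exp (-(δ / 2 * B2.rFn Rr r ℓ)) := by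
    rw [Real.exp_le_exp]
    have := mul_le_mul_of_nonneg_left hRr (by positivity : (0 : ℝ) ≤ δ / 2)
    linarith
  have hexp2 : Real.exp (-(δ * R)) ≤ Real.exp (-(δ / 2 * R)) := by
    rw [Real.exp_le_exp]
    have := mul_nonneg hδ hR0
    linarith
  have h2 : Real.exp (-(δ / 2 * R)) * t ^ 2 ≤ Cκ * ℓ ^ κ :=
    (mul_le_mul_of_nonneg_right hexp (sq_nonneg _)).trans hCκ
  have h3 : Real.exp (-(δ * R)) * t ^ 2 ≤ Cκ * ℓ ^ κ :=
    (mul_le_mul_of_nonneg_right hexp2 (sq_nonneg _)).trans h2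
  have hN : (0 : ℝ) ≤ Λ'.card := Nat.cast_nonneg _
  have hA : 0 ≤ c ^ 2 * |w| * q₁ * qs₁ * c₀ * Ssum * Λ'.card := by positivity
  calc _ ≤ c ^ 2 * |w| * ((Λ'.card * t * q₁) * (c₀ * Real.exp (-(δ / 2 * R)) * (qs₁ * t) * Ssum))
        + 1 / 2 * c ^ 2 * |w| * ((Λ'.card * t * q₁) * (c₀ * Real.exp (-(δ * R)) * (qs₁ * t) * Ssum)) := h1
    _ = c ^ 2 * |w| * q₁ * qs₁ * c₀ * Ssum * Λ'.card * (Real.exp (-(δ / 2 * R)) * t ^ 2)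
        + 1 / 2 * (c ^ 2 * |w| * q₁ * qs₁ * c₀ * Ssum * Λ'.card) * (Real.exp (-(δ * R)) * t ^ 2) := by ring
    _ ≤ c ^ 2 * |w| * q₁ * qs₁ * c₀ * Ssum * Λ'.card * (Cκ * ℓ ^ κ)
        + 1 / 2 * (c ^ 2 * |w| * q₁ * qs₁ * c₀ * Ssum * Λ'.card) * (Cκ * ℓ ^ κ) :=
        add_le_add (mul_le_mul_of_nonneg_left h2 hA) (mul_le_mul_of_nonneg_left h3 (by positivity))
    _ = 3 / 2 * c ^ 2 * |w| * q₁ * qs₁ * c₀ * Ssum * (Cκ * ℓ ^ κ) * Λ'.card := by ring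

end Error




end Literature.MathematicalPhysics.QuantumFieldTheory.Balaban1983to89.B2Eq237FormSplit
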